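import Literature.Analysis.PDE.NeumannHalfBallTangentialIBP
import HarnessLib

/-!
# Higher boundary regularity for weak solutions of the Neumann problem on a half-ball:
# `u ∈ W^{k+2,2}` near the flat boundary for data `F ∈ W^{k,2}`, `G ∈ W^{k+1,2}`

Topic `Analysis/PDE`. Theorem file (no definitions, no named facts; everything proved): Evans, *PDE*,
§6.3.2, Theorem 5 (boundary higher regularity) in the Neumann setting of
`NeumannHalfBallRegularity.lean` / `NeumannHalfBallNormal.lean`, on the discharge path of
`Literature.Geometry.Riemannian.sharpLogSobolevAVR_four`.

## Statements

* `IsWeakNeumannHalfBall.tangentialDerivative` (**the differentiated problem**): if `u` is a weak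
  solution of the Neumann problem on `U_R` with smooth coefficients, `∇u ∈ W^{1,2}(U_{r₂}; H)` with
  weak derivative `D∇u`, `F ∈ W^{1,2}(U_{r₂})` with weak derivative `DF`, and `G` has the weak
  derivative `DG` with `DG(·)v ∈ W^{1,2}(U_{r₂}; H)`, then for every TANGENTIAL `τ` the component
  `w = ⟪τ, ∇u⟫` is a weak solution of the Neumann problem on `U_{r₂}` with gradient `D∇u(·)τ`, source
  `DF(·)τ` and flux `DG(·)τ - (∂_τ A)∇u` (test the equation with `∂_τ ζ`, integrate by parts
  tangentially — no boundary term on the flat part, `integral_tangential_halfBall` — and use the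
  symmetry of the weak Hessian);
* `IsWeakNeumannHalfBall.memSobolevDomain_grad_higher` (**induction on `k`**, Evans §6.3.2 Thm. 5):
  for smooth, globally uniformly elliptic `A`, `ν ≠ 0`, data `F ∈ W^{k,2}(U_R)`,
  `G ∈ W^{k+1,2}(U_R; H)` and `0 < r < R`: `∇u ∈ W^{k+1,2}(U_r; H)`, and
  `IsWeakNeumannHalfBall.memSobolevDomain_higher`: `u ∈ W^{k+2,2}(U_r)`.

## References

* L. C. Evans, *Partial Differential Equations*, 2nd ed. (2010), §6.3.2 Theorem 5. [Evans2010]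
* M. E. Taylor, *Partial Differential Equations I*, 2nd ed. (2011), Ch. 5 §7, Propositions 7.2,
  7.4 (`u ∈ H^{k+2}` for data in `H^k`). [TaylorPDEI2011]
-/

noncomputable section

open MeasureTheory TopologicalSpace Set Function Filter Topology InnerProductSpace Metric
open scoped RealInnerProductSpace ENNReal NNReal ContDiff

namespace Literature.Analysis.PDE

open Literature.Analysis.FunctionSpaces Literature.Analysis.FluidPDE SobolevApprox

variable {H : Type*} [NormedAddCommGroup H] [InnerProductSpace ℝ H] [FiniteDimensional ℝ H]
  [MeasurableSpace H] [BorelSpace H]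

omit [FiniteDimensional ℝ H] [BorelSpace H] in
/-- Dropping several orders of a Sobolev function. [folklore] -/
theorem memSobolevDomain_of_le {Ω : Opens H} {μ : Measure H} {p : ℝ≥0∞} {W : Type*}
    [NormedAddCommGroup W] [NormedSpace ℝ W] {f : H → W} :
    ∀ {m n : ℕ}, m ≤ n → MemSobolevDomain n p Ω μ f → MemSobolevDomain m p Ω μ f
  | m, n, hmn, hf => by
    induction n generalizing m with
    | zero => rwa [Nat.le_zero.1 hmn]
    | succ n ih =>
      rcases Nat.lt_or_ge m (n + 1) with h | h
      · exact ih _ (Nat.lt_succ_iff.1 h) (memSobolevDomain_of_succ hf)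
      · rwa [le_antisymm hmn h]

namespace IsWeakNeumannHalfBall

variable {μ : Measure H} {ν z : H} {R : ℝ} {A : H → H →L[ℝ] H} {F : H → ℝ} {G : H → H}
  {u : H → ℝ} {gu : H → H}

set_option maxHeartbeats 3200000 in
/-- **The differentiated Neumann problem** (Evans, *PDE*, §6.3.2, proof of Theorem 5, "`ũ = D^α u`
is a weak solution of … with `f̃ = D^α f - Σ …`", here for a single tangential derivative and with the
conormal data carried by the flux `G`): with the hypotheses of the module docstring and a
tangential `τ` (`⟪τ, ν⟫ = 0`), `w = ⟪τ, ∇u⟫` is a weak solution on `U_{r₂}` with gradient `D∇u(·)τ`,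
source `DF(·)τ` and flux `DG(·)τ - (∂_τA)∇u`. [cite: Evans2010, §6.3.2 Theorem 5 (proof)] -/
theorem tangentialDerivative [μ.IsAddHaarMeasure]
    (hsol : IsWeakNeumannHalfBall μ ν z R A F G u gu) (hA : ContDiff ℝ ∞ A) {r₂ : ℝ}
    (hr₂ : r₂ ≤ R) {Dgu : H → H →L[ℝ] H} (hD : HasWeakFDerivOn (halfBall ν z r₂) μ gu Dgu)
    (hDm : ∀ v : H, MemLp (fun y => Dgu y v) 2 (μ.restrict (halfBall ν z r₂ : Set H)))
    (hguW : MemSobolevDomain 1 2 (halfBall ν z r₂) μ gu) {DF : H → H →L[ℝ] ℝ}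
    (hF : HasWeakFDerivOn (halfBall ν z r₂) μ F DF)
    (hDFm : ∀ v : H, MemLp (fun y => DF y v) 2 (μ.restrict (halfBall ν z r₂ : Set H)))
    {DG : H → H →L[ℝ] H} (hG : HasWeakFDerivOn (halfBall ν z R) μ G DG)
    (hDGW : ∀ v : H, MemSobolevDomain 1 2 (halfBall ν z r₂) μ (fun y => DG y v)) {τ : H}
    (hτ : ⟪τ, ν⟫ = 0) :
    IsWeakNeumannHalfBall μ ν z r₂ A (fun y => DF y τ) (fun y => DG y τ - (fderiv ℝ A y τ) (gu y))
      (fun y => ⟪τ, gu y⟫) (fun y => Dgu y τ) := by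
  set U : Opens H := halfBall ν z R with hU
  set U₂ : Opens H := halfBall ν z r₂ with hU₂
  have hU₂U : U₂ ≤ U := halfBall_mono hr₂
  have hUm : MeasurableSet (U : Set H) := U.isOpen.measurableSet
  have hU₂m : MeasurableSet (U₂ : Set H) := U₂.isOpen.measurableSet
  have hbU₂ : Bornology.IsBounded (U₂ : Set H) := isBounded_halfBall
  haveI : IsFiniteMeasure (μ.restrict (U₂ : Set H)) :=
    ⟨by rw [Measure.restrict_apply_univ]; exact measure_halfBall_lt_top μ⟩
  have hguU₂ : MemLp gu 2 (μ.restrict (U₂ : Set H)) :=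
    hsol.memLp_grad.mono_measure (Measure.restrict_mono_set μ hU₂U)
  have hguI : IntegrableOn gu (U₂ : Set H) μ := hguU₂.integrable (by norm_num)
  have hguloc : LocallyIntegrableOn gu (U₂ : Set H) μ := hguI.locallyIntegrableOn
  have huU₂ : HasWeakFDerivOn U₂ μ u (fun y => innerSL ℝ (gu y)) :=
    HasWeakFDerivOn.mono_set_holds hsol.hasWeakFDerivOn hU₂U
  have hGU₂ : HasWeakFDerivOn U₂ μ G DG := HasWeakFDerivOn.mono_set_holds hG hU₂U
  have hGm : MemLp G 2 (μ.restrict (U₂ : Set H)) :=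
    hsol.memSobolev_flux.memLp.mono_measure (Measure.restrict_mono_set μ hU₂U)
  have hFm : MemLp F 2 (μ.restrict (U₂ : Set H)) :=
    hsol.memLp_source.mono_measure (Measure.restrict_mono_set μ hU₂U)
  have hBτ : ContDiff ℝ ∞ fun y => fderiv ℝ A y τ :=
    (hA.fderiv_right (m := ∞) (by norm_cast)).clm_apply contDiff_const
  refine
    { memLp := memLp_const_inner hguU₂ τ
      memLp_grad := hDm τ
      hasWeakFDerivOn := hasWeakFDerivOn_const_inner_grad huU₂ hguloc hD τ
      memLp_source := hDFm τ
      memSobolev_flux := (hDGW τ).sub' (memSobolevDomain_clmField_apply hbU₂ hBτ hguW)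
      weak_eq := fun ζ hζ hζc hζs => ?_ }
  -- notation
  set b := stdOrthonormalBasis ℝ H with hb
  set gw : H → H := fun y => Dgu y τ with hgw
  set Bτ : H → H →L[ℝ] H := fun y => fderiv ℝ A y τ with hBτ_def
  have hζd : Differentiable ℝ ζ := hζ.differentiable (by simp)
  have hζ2 : ContDiff ℝ 2 ζ := hζ.of_le (by norm_cast)
  -- the derived test functions
  have hθ : ∀ w : H, ContDiff ℝ ∞ fun y => fderiv ℝ ζ y w := fun w =>
    (hζ.fderiv_right (m := ∞) (by norm_cast)).clm_apply contDiff_const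
  have hθc : ∀ w : H, HasCompactSupport fun y => fderiv ℝ ζ y w := fun w => hζc.fderiv_apply (𝕜 := ℝ) w
  have hθs : ∀ w : H, tsupport (fun y => fderiv ℝ ζ y w) ⊆ ball z r₂ := fun w =>
    (tsupport_fderiv_apply_subset ℝ w).trans hζs
  have hθbd : ∀ w : H, ∃ C, ∀ y, ‖fderiv ℝ ζ y w‖ ≤ C := fun w =>
    (hθ w).continuous.bounded_above_of_compact_support (hθc w)
  obtain ⟨Cζ, hCζ⟩ : ∃ C, ∀ y, ‖ζ y‖ ≤ C := hζ.continuous.bounded_above_of_compact_support hζc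
  obtain ⟨CDζ, hCDζ⟩ : ∃ C, ∀ y, ‖fderiv ℝ ζ y‖ ≤ C :=
    (hζ.continuous_fderiv (by simp)).bounded_above_of_compact_support (hζc.fderiv (𝕜 := ℝ))
  -- STEP 1: the weak formulation tested with `∂_τ ζ`, moved to `U₂`
  have hweak := hsol.weak_eq (fun y => fderiv ℝ ζ y τ) (hθ τ) (hθc τ)
    ((hθs τ).trans (ball_subset_ball hr₂))
  have hoff : ∀ y, y ∉ (U₂ : Set H) → y ∈ (U : Set H) → y ∉ tsupport ζ := fun y hy2 hy hyζ =>
    hy2 ⟨hζs hyζ, hy.2⟩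
  have hθτ0 : ∀ y, y ∉ tsupport ζ → fderiv ℝ (fun y => fderiv ℝ ζ y τ) y = 0 := fun y hy =>
    fderiv_of_notMem_tsupport ℝ fun h' => hy (tsupport_fderiv_apply_subset ℝ τ h')
  have hτ0 : ∀ y, y ∉ tsupport ζ → fderiv ℝ ζ y τ = 0 := fun y hy => by
    rw [fderiv_of_notMem_tsupport ℝ hy, zero_apply]
  rw [setIntegral_eq_of_subset_of_forall_sdiff_eq_zero hUm hU₂U
      (fun y hy => by rw [hθτ0 y (hoff y hy.2 hy.1), zero_apply]),
    setIntegral_eq_of_subset_of_forall_sdiff_eq_zero hUm hU₂U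
      (fun y hy => by rw [hθτ0 y (hoff y hy.2 hy.1), hτ0 y (hoff y hy.2 hy.1), zero_apply,
        mul_zero, add_zero])] at hweak
  -- Schwarz: `∂_w ∂_τ ζ = ∂_τ ∂_w ζ`
  have hschwarz : ∀ y w, fderiv ℝ (fun y => fderiv ℝ ζ y τ) y w =
      fderiv ℝ (fun y => fderiv ℝ ζ y w) y τ := fun y w => fderiv_fderiv_apply_comm hζ2 y w τ
  -- integrability helpers on `U₂`
  have hLI : ∀ {f : H → ℝ}, MemLp f 2 (μ.restrict (U₂ : Set H)) → Integrable f (μ.restrict (U₂ : Set H)) :=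
    fun {f} hf => hf.integrable (by norm_num)
  have hbm : ∀ {ψ : H → ℝ}, Continuous ψ → (∃ C, ∀ y, ‖ψ y‖ ≤ C) → ∀ {f : H → ℝ},
      MemLp f 2 (μ.restrict (U₂ : Set H)) →
        Integrable (fun y => ψ y * f y) (μ.restrict (U₂ : Set H)) := fun {ψ} hψ hψb {f} hf => by
    obtain ⟨C, hC⟩ := hψb
    exact (hLI hf).bdd_mul hψ.aestronglyMeasurable (Eventually.of_forall hC)
  have hclm : ∀ {V : H → H}, MemLp V 2 (μ.restrict (U₂ : Set H)) →
      Integrable (fun y => fderiv ℝ ζ y (V y)) (μ.restrict (U₂ : Set H)) := fun {V} hV =>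
    (ContinuousLinearMap.id ℝ (H →L[ℝ] ℝ)).integrable_of_bilin_of_bdd_left CDζ
      (hζ.continuous_fderiv (by simp)).aestronglyMeasurable (Eventually.of_forall hCDζ)
      (hV.integrable (by norm_num))
  obtain ⟨MA, hMA0, hMA⟩ := exists_bound_coeff hA.continuous z r₂
  obtain ⟨MB, hMB0, hMB⟩ := exists_bound_coeff hBτ.continuous z r₂
  have hU₂ball : (U₂ : Set H) ⊆ closedBall z r₂ := halfBall_subset_ball.trans ball_subset_closedBall
  have hAgu : MemLp (fun y => A y (gu y)) 2 (μ.restrict (U₂ : Set H)) :=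
    (memLp_coeff_apply hU₂m hA.continuous hMA0 (fun y hy => hMA y (hU₂ball hy)) hguU₂).1
  have hAgw : MemLp (fun y => A y (gw y)) 2 (μ.restrict (U₂ : Set H)) :=
    (memLp_coeff_apply hU₂m hA.continuous hMA0 (fun y hy => hMA y (hU₂ball hy)) (hDm τ)).1
  have hBgu : MemLp (fun y => Bτ y (gu y)) 2 (μ.restrict (U₂ : Set H)) :=
    (memLp_coeff_apply hU₂m hBτ.continuous hMB0 (fun y hy => hMB y (hU₂ball hy)) hguU₂).1
  have hDGτ : MemLp (fun y => DG y τ) 2 (μ.restrict (U₂ : Set H)) := (hDGW τ).memLp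
  -- STEP 2: the left-hand side `∫ D(∂_τζ)(A∇u) = -∫ Dζ((∂_τA)∇u) - ∫ Dζ(A ∇w)`
  have hM : ∀ i, HasWeakDerivAlong U₂ μ (fun _ => τ) (fun y => ⟪b i, A y (gu y)⟫)
      (fun y => ⟪b i, Bτ y (gu y)⟫ + ⟪b i, A y (gw y)⟫) := fun i =>
    (hD.hasWeakDerivAlong contDiff_const (X := fun _ => τ)).const_inner_clmField_apply hA (b i)
  have hMi : ∀ i, MemLp (fun y => ⟪b i, A y (gu y)⟫) 2 (μ.restrict (U₂ : Set H)) := fun i =>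
    memLp_const_inner hAgu (b i)
  have hM'i : ∀ i, MemLp (fun y => ⟪b i, Bτ y (gu y)⟫ + ⟪b i, A y (gw y)⟫) 2
      (μ.restrict (U₂ : Set H)) := fun i => (memLp_const_inner hBgu (b i)).add (memLp_const_inner hAgw (b i))
  have hIBP_M : ∀ i, ∫ y in (U₂ : Set H), (fderiv ℝ (fun y => fderiv ℝ ζ y (b i)) y τ) *
      ⟪b i, A y (gu y)⟫ ∂μ = -∫ y in (U₂ : Set H), fderiv ℝ ζ y (b i) *
        (⟪b i, Bτ y (gu y)⟫ + ⟪b i, A y (gw y)⟫) ∂μ := fun i => by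
    have h := (hM i).integral_tangential_halfBall hτ (hLI (hMi i)) (hLI (hM'i i)) (hθ (b i))
      (hθc (b i)) (hθs (b i))
    simpa only [smul_eq_mul] using h
  have hLHS : ∫ y in (U₂ : Set H), fderiv ℝ (fun y => fderiv ℝ ζ y τ) y (A y (gu y)) ∂μ =
      -(∫ y in (U₂ : Set H), fderiv ℝ ζ y (Bτ y (gu y)) ∂μ) -
        ∫ y in (U₂ : Set H), fderiv ℝ ζ y (A y (gw y)) ∂μ := by
    have e1 : ∀ y, fderiv ℝ (fun y => fderiv ℝ ζ y τ) y (A y (gu y)) =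
        ∑ i, (fderiv ℝ (fun y => fderiv ℝ ζ y (b i)) y τ) * ⟪b i, A y (gu y)⟫ := fun y => by
      rw [clm_apply_expand b (fderiv ℝ (fun y => fderiv ℝ ζ y τ) y) (A y (gu y))]
      refine Finset.sum_congr rfl fun i _ => ?_
      rw [hschwarz y (b i), mul_comm]
    have e2 : ∀ y, fderiv ℝ ζ y (Bτ y (gu y)) + fderiv ℝ ζ y (A y (gw y)) =
        ∑ i, fderiv ℝ ζ y (b i) * (⟪b i, Bτ y (gu y)⟫ + ⟪b i, A y (gw y)⟫) := fun y => by
      rw [clm_apply_expand b (fderiv ℝ ζ y) (Bτ y (gu y)), clm_apply_expand b (fderiv ℝ ζ y) (A y (gw y)),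
        ← Finset.sum_add_distrib]
      refine Finset.sum_congr rfl fun i _ => ?_
      ring
    have hint1 : ∀ i, Integrable (fun y => (fderiv ℝ (fun y => fderiv ℝ ζ y (b i)) y τ) *
        ⟪b i, A y (gu y)⟫) (μ.restrict (U₂ : Set H)) := fun i =>
      hbm (((hθ (b i)).continuous_fderiv (by simp)).clm_apply continuous_const)
        (((hθ (b i)).continuous_fderiv (by simp)).clm_apply continuous_const
          |>.bounded_above_of_compact_support ((hθc (b i)).fderiv_apply (𝕜 := ℝ) τ)) (hMi i)
    have hint2 : ∀ i, Integrable (fun y => fderiv ℝ ζ y (b i) *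
        (⟪b i, Bτ y (gu y)⟫ + ⟪b i, A y (gw y)⟫)) (μ.restrict (U₂ : Set H)) := fun i =>
      hbm (hθ (b i)).continuous (hθbd (b i)) (hM'i i)
    calc ∫ y in (U₂ : Set H), fderiv ℝ (fun y => fderiv ℝ ζ y τ) y (A y (gu y)) ∂μ
        = ∫ y in (U₂ : Set H), ∑ i, (fderiv ℝ (fun y => fderiv ℝ ζ y (b i)) y τ) *
            ⟪b i, A y (gu y)⟫ ∂μ := integral_congr_ae (Eventually.of_forall e1)
      _ = ∑ i, ∫ y in (U₂ : Set H), (fderiv ℝ (fun y => fderiv ℝ ζ y (b i)) y τ) *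
            ⟪b i, A y (gu y)⟫ ∂μ := integral_finsetSum _ (fun i _ => hint1 i)
      _ = ∑ i, -∫ y in (U₂ : Set H), fderiv ℝ ζ y (b i) *
            (⟪b i, Bτ y (gu y)⟫ + ⟪b i, A y (gw y)⟫) ∂μ := Finset.sum_congr rfl fun i _ => hIBP_M i
      _ = -∫ y in (U₂ : Set H), ∑ i, fderiv ℝ ζ y (b i) *
            (⟪b i, Bτ y (gu y)⟫ + ⟪b i, A y (gw y)⟫) ∂μ := by
          rw [Finset.sum_neg_distrib, integral_finsetSum _ (fun i _ => hint2 i)]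
      _ = -∫ y in (U₂ : Set H), (fderiv ℝ ζ y (Bτ y (gu y)) + fderiv ℝ ζ y (A y (gw y))) ∂μ := by
          congr 1; exact integral_congr_ae (Eventually.of_forall fun y => (e2 y).symm)
      _ = -(∫ y in (U₂ : Set H), fderiv ℝ ζ y (Bτ y (gu y)) ∂μ) -
            ∫ y in (U₂ : Set H), fderiv ℝ ζ y (A y (gw y)) ∂μ := by
          rw [integral_add (hclm hBgu) (hclm hAgw)]; ring
  -- STEP 3: the right-hand side
  have hRHS1 : ∫ y in (U₂ : Set H), F y * fderiv ℝ ζ y τ ∂μ =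
      -∫ y in (U₂ : Set H), DF y τ * ζ y ∂μ := by
    have h := hF.integral_tangential_halfBall hτ (hLI hFm) (hLI (hDFm τ)) hζ hζc hζs
    simp only [smul_eq_mul] at h
    rw [show (fun y => F y * fderiv ℝ ζ y τ) = fun y => fderiv ℝ ζ y τ * F y by funext y; ring, h]
    congr 1
    exact integral_congr_ae (Eventually.of_forall fun y => by ring)
  have hGi : ∀ i, HasWeakDerivAlong U₂ μ (fun _ => τ) (fun y => ⟪b i, G y⟫) (fun y => ⟪b i, DG y τ⟫) :=
    fun i => by
      have := (hGU₂.hasWeakDerivAlong contDiff_const (X := fun _ => τ)).clm_apply contDiff_const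
        (innerSL ℝ (b i))
      simpa only [innerSL_apply_apply] using this
  have hIBP_G : ∀ i, ∫ y in (U₂ : Set H), (fderiv ℝ (fun y => fderiv ℝ ζ y (b i)) y τ) *
      ⟪b i, G y⟫ ∂μ = -∫ y in (U₂ : Set H), fderiv ℝ ζ y (b i) * ⟪b i, DG y τ⟫ ∂μ := fun i => by
    have h := (hGi i).integral_tangential_halfBall hτ (hLI (memLp_const_inner hGm (b i)))
      (hLI (memLp_const_inner hDGτ (b i))) (hθ (b i)) (hθc (b i)) (hθs (b i))
    simpa only [smul_eq_mul] using h
  have hRHS2 : ∫ y in (U₂ : Set H), fderiv ℝ (fun y => fderiv ℝ ζ y τ) y (G y) ∂μ =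
      -∫ y in (U₂ : Set H), fderiv ℝ ζ y (DG y τ) ∂μ := by
    have e1 : ∀ y, fderiv ℝ (fun y => fderiv ℝ ζ y τ) y (G y) =
        ∑ i, (fderiv ℝ (fun y => fderiv ℝ ζ y (b i)) y τ) * ⟪b i, G y⟫ := fun y => by
      rw [clm_apply_expand b (fderiv ℝ (fun y => fderiv ℝ ζ y τ) y) (G y)]
      refine Finset.sum_congr rfl fun i _ => ?_
      rw [hschwarz y (b i), mul_comm]
    have e2 : ∀ y, fderiv ℝ ζ y (DG y τ) = ∑ i, fderiv ℝ ζ y (b i) * ⟪b i, DG y τ⟫ := fun y => by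
      rw [clm_apply_expand b (fderiv ℝ ζ y) (DG y τ)]
      refine Finset.sum_congr rfl fun i _ => ?_
      ring
    have hint1 : ∀ i, Integrable (fun y => (fderiv ℝ (fun y => fderiv ℝ ζ y (b i)) y τ) *
        ⟪b i, G y⟫) (μ.restrict (U₂ : Set H)) := fun i =>
      hbm (((hθ (b i)).continuous_fderiv (by simp)).clm_apply continuous_const)
        (((hθ (b i)).continuous_fderiv (by simp)).clm_apply continuous_const
          |>.bounded_above_of_compact_support ((hθc (b i)).fderiv_apply (𝕜 := ℝ) τ))
        (memLp_const_inner hGm (b i))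
    have hint2 : ∀ i, Integrable (fun y => fderiv ℝ ζ y (b i) * ⟪b i, DG y τ⟫)
        (μ.restrict (U₂ : Set H)) := fun i =>
      hbm (hθ (b i)).continuous (hθbd (b i)) (memLp_const_inner hDGτ (b i))
    calc ∫ y in (U₂ : Set H), fderiv ℝ (fun y => fderiv ℝ ζ y τ) y (G y) ∂μ
        = ∫ y in (U₂ : Set H), ∑ i, (fderiv ℝ (fun y => fderiv ℝ ζ y (b i)) y τ) * ⟪b i, G y⟫ ∂μ :=
          integral_congr_ae (Eventually.of_forall e1)
      _ = ∑ i, ∫ y in (U₂ : Set H), (fderiv ℝ (fun y => fderiv ℝ ζ y (b i)) y τ) * ⟪b i, G y⟫ ∂μ :=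
          integral_finsetSum _ (fun i _ => hint1 i)
      _ = ∑ i, -∫ y in (U₂ : Set H), fderiv ℝ ζ y (b i) * ⟪b i, DG y τ⟫ ∂μ :=
          Finset.sum_congr rfl fun i _ => hIBP_G i
      _ = -∫ y in (U₂ : Set H), ∑ i, fderiv ℝ ζ y (b i) * ⟪b i, DG y τ⟫ ∂μ := by
          rw [Finset.sum_neg_distrib, integral_finsetSum _ (fun i _ => hint2 i)]
      _ = -∫ y in (U₂ : Set H), fderiv ℝ ζ y (DG y τ) ∂μ := by
          congr 1; exact integral_congr_ae (Eventually.of_forall fun y => (e2 y).symm)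
  -- STEP 4: combine
  have hF1 : Integrable (fun y => F y * fderiv ℝ ζ y τ) (μ.restrict (U₂ : Set H)) := by
    have := hbm (hθ τ).continuous (hθbd τ) hFm
    simpa only [mul_comm] using this
  have hF2 : Integrable (fun y => fderiv ℝ (fun y => fderiv ℝ ζ y τ) y (G y)) (μ.restrict (U₂ : Set H)) := by
    obtain ⟨C, hC⟩ := ((hθ τ).continuous_fderiv (by simp)).bounded_above_of_compact_support
      ((hθc τ).fderiv (𝕜 := ℝ))
    exact (ContinuousLinearMap.id ℝ (H →L[ℝ] ℝ)).integrable_of_bilin_of_bdd_left C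
      ((hθ τ).continuous_fderiv (by simp)).aestronglyMeasurable (Eventually.of_forall hC)
      (hGm.integrable (by norm_num))
  rw [integral_add hF1 hF2, hLHS, hRHS1, hRHS2] at hweak
  -- the goal
  have hint_a : Integrable (fun y => DF y τ * ζ y) (μ.restrict (U₂ : Set H)) := by
    have := hbm hζ.continuous ⟨Cζ, hCζ⟩ (hDFm τ)
    simpa only [mul_comm] using this
  have hint_b : Integrable (fun y => fderiv ℝ ζ y (DG y τ - Bτ y (gu y))) (μ.restrict (U₂ : Set H)) :=
    hclm (hDGτ.sub hBgu)
  rw [integral_add hint_a hint_b]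
  have e3 : ∫ y in (U₂ : Set H), fderiv ℝ ζ y (DG y τ - Bτ y (gu y)) ∂μ =
      (∫ y in (U₂ : Set H), fderiv ℝ ζ y (DG y τ) ∂μ) - ∫ y in (U₂ : Set H), fderiv ℝ ζ y (Bτ y (gu y)) ∂μ := by
    rw [← integral_sub (hclm hDGτ) (hclm hBgu)]
    refine integral_congr_ae (Eventually.of_forall fun y => ?_)
    simp only [map_sub]
  rw [e3]
  linarith

set_option maxHeartbeats 1600000 in
/-- **Boundary higher regularity for the Neumann problem** (Evans, *PDE*, §6.3.2, Theorem 5;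
Taylor, *PDE I*, Ch. 5 §7, Prop. 7.4): for smooth, globally uniformly elliptic coefficients `A`,
`ν ≠ 0`, data `F ∈ W^{k,2}(U_R)`, `G ∈ W^{k+1,2}(U_R; H)` and `0 < r < R`, the weak gradient of a
weak solution of the Neumann problem on the half-ball `U_R` lies in `W^{k+1,2}(U_r; H)`. Induction on
`k`: the tangential derivatives `⟪τ, ∇u⟫` solve the differentiated problem (`tangentialDerivative`)
with data one order lower on an intermediate half-ball, and the normal derivative is recovered
from the equation at every order (`exists_hasWeakFDerivOn_grad_of_tangential`).
[cite: Evans2010, §6.3.2 Theorem 5] -/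
theorem memSobolevDomain_grad_higher [μ.IsAddHaarMeasure] (hA : ContDiff ℝ ∞ A) {lam : ℝ}
    (hlam : 0 < lam) (hell : ∀ (y : H) (ξ : H), lam * ‖ξ‖ ^ 2 ≤ ⟪A y ξ, ξ⟫) (hν : ν ≠ 0) :
    ∀ (k : ℕ) {F : H → ℝ} {G : H → H} {u : H → ℝ} {gu : H → H} {R r : ℝ},
      IsWeakNeumannHalfBall μ ν z R A F G u gu → MemSobolevDomain k 2 (halfBall ν z R) μ F →
      MemSobolevDomain (k + 1) 2 (halfBall ν z R) μ G → 0 < r → r < R →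
      MemSobolevDomain (k + 1) 2 (halfBall ν z r) μ gu
  | 0, F, G, u, gu, R, r, hsol, _, _, hr, hrR => hsol.memSobolevDomain_grad hA hlam hell hν hr hrR
  | k + 1, F, G, u, gu, R, r, hsol, hFk, hGk, hr, hrR => by
    -- an intermediate radius
    set r₂ : ℝ := (r + R) / 2 with hr₂_def
    have hrr₂ : r < r₂ := by rw [hr₂_def]; linarith
    have hr₂R : r₂ < R := by rw [hr₂_def]; linarith
    have hr₂ : 0 < r₂ := hr.trans hrr₂
    have h2R : halfBall ν z r₂ ≤ halfBall ν z R := halfBall_mono hr₂R.le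
    have hr2 : halfBall ν z r ≤ halfBall ν z r₂ := halfBall_mono hrr₂.le
    have hrRle : halfBall ν z r ≤ halfBall ν z R := halfBall_mono hrR.le
    have hb₂ : Bornology.IsBounded (halfBall ν z r₂ : Set H) := isBounded_halfBall
    -- (a) the induction hypothesis for `u` on `U_{r₂}`
    have hgu₂ : MemSobolevDomain (k + 1) 2 (halfBall ν z r₂) μ gu :=
      memSobolevDomain_grad_higher hA hlam hell hν k hsol (memSobolevDomain_of_succ hFk)
        (memSobolevDomain_of_succ hGk) hr₂ hr₂R
    obtain ⟨hgu0, Dgu, hD, hDk⟩ := hgu₂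
    have hDm : ∀ v : H, MemLp (fun y => Dgu y v) 2 (μ.restrict (halfBall ν z r₂ : Set H)) :=
      fun v => (hDk v).memLp
    have hguW1 : MemSobolevDomain 1 2 (halfBall ν z r₂) μ gu :=
      ⟨hgu0, Dgu, hD, fun v => (memSobolevDomain_zero_iff).2 (hDm v)⟩
    have hgu₂' : MemSobolevDomain (k + 1) 2 (halfBall ν z r₂) μ gu := ⟨hgu0, Dgu, hD, hDk⟩
    -- (b) the data on `U_{r₂}`
    obtain ⟨hF0, DF, hF, hDFk⟩ := MemSobolevDomain.mono_set_holds hFk h2R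
    have hDFm : ∀ v : H, MemLp (fun y => DF y v) 2 (μ.restrict (halfBall ν z r₂ : Set H)) :=
      fun v => (hDFk v).memLp
    obtain ⟨hG0, DG, hG, hDGk⟩ := hGk
    have hDGW : ∀ v : H, MemSobolevDomain (k + 1) 2 (halfBall ν z r₂) μ (fun y => DG y v) :=
      fun v => MemSobolevDomain.mono_set_holds (hDGk v) h2R
    have hDGW1 : ∀ v : H, MemSobolevDomain 1 2 (halfBall ν z r₂) μ (fun y => DG y v) :=
      fun v => memSobolevDomain_of_le (Nat.le_add_left 1 k) (hDGW v)
    -- (c) the tangential derivatives, by the induction hypothesis for the differentiated problem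
    have htan : ∀ τ : H, ⟪τ, ν⟫ = 0 → ∃ gτ : H → H,
        MemSobolevDomain (k + 1) 2 (halfBall ν z r) μ gτ ∧
          HasWeakDerivAlong (halfBall ν z r) μ (fun _ => τ) gu gτ := fun τ hτ => by
      have hw := hsol.tangentialDerivative hA hr₂R.le hD hDm hguW1 hF hDFm hG hDGW1 hτ
      have hBτ : ContDiff ℝ ∞ fun y => fderiv ℝ A y τ :=
        (hA.fderiv_right (m := ∞) (by norm_cast)).clm_apply contDiff_const
      have hGw : MemSobolevDomain (k + 1) 2 (halfBall ν z r₂) μ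
          (fun y => DG y τ - (fderiv ℝ A y τ) (gu y)) :=
        (hDGW τ).sub' (memSobolevDomain_clmField_apply hb₂ hBτ hgu₂')
      have ih := memSobolevDomain_grad_higher hA hlam hell hν k hw (hDFk τ) hGw hr hrr₂
      exact ⟨fun y => Dgu y τ, ih,
        (hD.hasWeakDerivAlong contDiff_const (X := fun _ => τ)).mono hr2⟩
    -- (d) the normal derivative from the equation, at order `k + 1`
    have hgum : MemSobolevDomain (k + 1) 2 (halfBall ν z r) μ gu :=
      MemSobolevDomain.mono_set_holds hgu₂' hr2
    have hFm : MemSobolevDomain (k + 1) 2 (halfBall ν z r) μ F :=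
      MemSobolevDomain.mono_set_holds hFk hrRle
    have hDGex : ∃ DG : H → H →L[ℝ] H, HasWeakFDerivOn (halfBall ν z R) μ G DG ∧
        ∀ v : H, MemSobolevDomain (k + 1) 2 (halfBall ν z r) μ (fun y => DG y v) :=
      ⟨DG, hG, fun v => MemSobolevDomain.mono_set_holds (hDGk v) hrRle⟩
    obtain ⟨Dgu', hD', hD'k⟩ := hsol.exists_hasWeakFDerivOn_grad_of_tangential hA hlam hell hν
      hrR.le htan hgum hFm hDGex
    exact ⟨hgum.memLp, Dgu', hD', hD'k⟩

/-- **`u ∈ W^{k+2,2}` near the flat boundary** (Evans, *PDE*, §6.3.2, Theorem 5): with the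
hypotheses of `memSobolevDomain_grad_higher`, `u ∈ W^{k+2,2}(U_r)`.
[cite: Evans2010, §6.3.2 Theorem 5] -/
theorem memSobolevDomain_higher [μ.IsAddHaarMeasure]
    (hsol : IsWeakNeumannHalfBall μ ν z R A F G u gu) (hA : ContDiff ℝ ∞ A) {lam : ℝ}
    (hlam : 0 < lam) (hell : ∀ (y : H) (ξ : H), lam * ‖ξ‖ ^ 2 ≤ ⟪A y ξ, ξ⟫) (hν : ν ≠ 0) {k : ℕ}
    (hFk : MemSobolevDomain k 2 (halfBall ν z R) μ F)
    (hGk : MemSobolevDomain (k + 1) 2 (halfBall ν z R) μ G) {r : ℝ} (hr : 0 < r) (hrR : r < R) :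
    MemSobolevDomain (k + 2) 2 (halfBall ν z r) μ u := by
  have hgu := memSobolevDomain_grad_higher hA hlam hell hν k hsol hFk hGk hr hrR
  have hle : halfBall ν z r ≤ halfBall ν z R := halfBall_mono hrR.le
  refine ⟨hsol.memLp.mono_measure (Measure.restrict_mono_set μ hle), _,
    HasWeakFDerivOn.mono_set_holds hsol.hasWeakFDerivOn hle, fun v => ?_⟩
  have h := hgu.const_inner v
  refine memSobolevDomain_congr h fun y _ => ?_
  show innerSL ℝ (gu y) v = ⟪v, gu y⟫
  rw [innerSL_apply_apply, real_inner_comm]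

end IsWeakNeumannHalfBall

end Literature.Analysis.PDE

end
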